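import Literature.Geometry.Lorentzian.AsymptoticFlatness
import Literature.Geometry.Lorentzian.RicciSection
import Literature.Geometry.Lorentzian.Geodesic
import HarnessLib

/-!
# Complete static vacuum ends diffeomorphic to `ℝ³ ∖ B` are asymptotically flat (Reiris 2014)

This Literature file vendors, as ONE **named fact** (D-0014) in the vocabulary of the Lorentz
prelude (`AFEnd`, `AFEnd.hCoeff`, `pullbackBilin … ricciCLM` = `AFEnd.ricciCoeff`,
`InitialDataSet`, `PseudoRiemannianMetric.ricci/hessian/dalembertian`, `IsGeodesicallyComplete`), the **static special case** of M. Reiris's theorem that *strongly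
stationary vacuum ends are asymptotically flat with Schwarzschildian fall-off* —
*Stationary solutions and asymptotic flatness I, II*, Class. Quantum Grav. 31 (2014) 155012 and
155013 (arXiv:1002.1172, arXiv:1310.0339). It is the static-vacuum-END theorem requested by the
`FinalStateConjecture` decomposition cell (work item `wi-97106`, «StaticLimitEndAF», first lemma of
`StaticNoHair` stmt-29011 / door D₁ `PointwiseStaticNoHair`): asymptotic flatness of a static
limit end follows from COMPLETENESS of the end, its topology `ℝ³ ∖ B`, and a lapse bounded away
from zero — no a priori decay is assumed.

## The printed statements (arXiv texts, held)

* Reiris I (arXiv:1002.1172), §1.1. Setting: a strictly stationary vacuum space-time with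
  time-like Killing field `X`; on the quotient three-manifold `M` the data are the quotient metric
  `g̃`, the twist form `ω` and `u > 0` with `u² := |X|² = -⟨X, X⟩`; the vacuum equations become
  `Ric_g̃ = u⁻¹ ∇²_g̃ u + 2u⁻⁴(ω ⊗ ω − |ω|²_g̃ g̃)`, `Δ_g̃ u = −2u⁻³|ω|²_g̃`,
  `div_g̃ ω = 3⟨∇ ln u, ω⟩`, `dω = 0` ((E1)–(E4)).  **Definition 1**: "A stationary solution has
  *regular ends* if there is a compact set `𝒦` such that `M ∖ 𝒦 ≈ ∪ Eᵢ`" (disjoint), "every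
  connected component `Eᵢ` is homeomorphic to `ℝ³ ∖ B`" (`B` an open ball) and "making
  `g = |X|² g̃`, then every `(Eᵢ, g)` is, as a metric space, complete".  **Theorem 1**: "Let
  `(E, (g̃, ω, u))` be a regular end of a stationary solution. Then there is a coordinate system
  `{x̄ = (x₁, x₂, x₃)}`, such that, the metric `g̃` is asymptotically flat, namely
  `|δ_ij − g_ij| ≤ c/|x̄|` (5), `|∂_k g_ij| ≤ c/|x̄|²` (6). And we have the fall offs
  `|Ric_ij| ≤ c/|x̄|³` (7), `|∂_i u| + |ω_i| ≤ c/|x̄|²` (8), plus further progressive decay for the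
  norm of the derivatives `∂_m Ric_ij`, `∂_m ∂u`, `∂_m ω_i`".  §1 (p. 2): "If the physical metric
  `g̃` is complete and the norm `|X|` of the stationary Killing field remains away from zero
  outside a compact set, namely satisfies `|X| ≥ c > 0`, then `g` is complete and (by Theorem 1)
  the stationary solution is asymptotically flat and with a Kerr-type of fall off."
* Reiris II (arXiv:1310.0339), §1: "If the manifold `M` is diffeomorphic to `ℝ³` minus an open
  ball, the metric `g` is complete and `u` is bounded below away from zero then `(M; g, ω, u)` is
  said to be a *strongly stationary end*."  **Theorem 1**: "Let `E` be a strongly stationary end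
  having cubic volume growth. Then `E` is WAF and therefore AF with Schwarzschidian fall off."
  And: "as was indicated in [SSI], any strongly stationary end enjoys necessarily cubic volume
  growth due to quite general geometric facts [arXiv:1212.1317]. From this and Theorem 1 we deduce
  therefore that Strongly Stationary ends are always asymptotically flat with Schwarzschidian fall
  off (c.f. Corollary 1 in [SSI])."
* Static case: `ω = 0`, so (E1)–(E2) read `u Ric_g̃ = ∇²u`, `Δ_g̃ u = 0` — the static vacuum
  Einstein equations (Anderson, Ann. Henri Poincaré 1 (2000) 995–1042 = arXiv:gr-qc/0001018,
  (0.1): "`u r = D²u`, `Δu = 0`, on a Riemannian 3-manifold `(M, g)`, with `u` a positive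
  function").  Related, NOT vendored here: Anderson's Theorem 0.3 (loc. cit.; ends of static
  vacuum solutions with pseudo-compact boundary are asymptotically flat or small), Kennefick–Ó
  Murchadha (Class. Quantum Grav. 12 (1995), arXiv:gr-qc/9311012; weak decay implies
  Schwarzschildian decay), and the higher-derivative ("progressive") decay of Theorem 1.

## What is vendored, and how the hypotheses were strengthened (never weakened)

`Reiris2014_staticVacuumEnd_asymptoticallyFlat`: for a connected boundaryless `3`-manifold `X`
carrying data `D` (only the Riemannian metric `h = D.h`, playing `g̃`, is used), an end structure
`e : AFEnd X` with `e.IsSoleEnd` (so `X` is a compact set plus ONE end `≅ {‖x‖ > R}`), and a smooth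
`u : X → ℝ` which on the end `e.U` is bounded below by some `u₀ > 0` and satisfies the static
vacuum equations there (`IsStaticVacuumOn D u e.U`), IF `(X, h)` is geodesically complete THEN
there are an end structure `e'` of the same (sole) end and constants `c, R₁` such that in the chart
of `e'`, for `‖x‖ ≥ R₁`: `|h_ij(x) − δ_ij| ≤ c/‖x‖`, `|∂_k h_ij(x)| ≤ c/‖x‖²`,
`|Ric_ij(x)| ≤ c/‖x‖³`, `|∂_i u(x)| ≤ c/‖x‖²` — the printed (5)–(8) with `ω = 0`.
The printed hypotheses follow from ours: `E := chart⁻¹{‖x‖ ≥ R″} ⊆ e.U` (`R″` large) is closed in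
`X` (`AFEnd.isClosed_far`) and diffeomorphic to `ℝ³` minus an open ball; geodesic completeness of
the boundaryless `(X, h)` gives completeness of `(X, d_h)` (Hopf–Rinow) hence of the closed `E`
(the induced length metric of a submanifold with smooth compact boundary is locally equivalent to
the restricted distance), and `u ≥ u₀ > 0` on `E` makes `(E, u²h)` complete
(`d_{u²h} ≥ u₀ d_h`) — Reiris I §1's "simple and important instance"; `u > 0` and the equations
are asked on all of `e.U ⊇ E`.  The conclusion is weakened: only the displayed orders (5)–(8), as
`∃ c`, componentwise in the standard frame.  Grade: REFEREED (CQG 31 (2014)); statements read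
from the arXiv texts (the published Part I reorganises the argument through "weakly asymptotically
flat" ends; the combined theorem is the one quoted from Part II §1).  Nothing here asserts the
Final State Conjecture or any no-hair statement.

## Main definitions (namespace `Literature.Geometry.Lorentzian`)

* `IsStaticVacuumOn D u A` — the static vacuum Einstein equations for `(h, u)` on `A ⊆ X`
  (definition with body; `IsStaticVacuumOn.mono`).
* `AFEnd.scalarCoeff e f` — a scalar function read in the chart of an end (junk value `0` inside
  the ball, like `AFEnd.scalarCurvatureCoeff`).  The Ricci components are written as the pullback
  `pullbackBilin e'.dataChart (D.metric.ricciCLM ·) z` at points `z` of the exterior region, which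
  is the tree's `AFEnd.ricciCoeff e' D z` (`RicciChartDecay.lean`, `ricciCoeff_of_lt`) unfolded —
  that module is not imported here only to keep this file's import cone light.
* `Reiris2014_staticVacuumEnd_asymptoticallyFlat` — the named fact; `.apply` its hypothesis form.

## References

* [Reiris2014SSAF1] M. Reiris, *Stationary solutions and asymptotic flatness I*, Class. Quantum
  Grav. 31 (2014) 155012, arXiv:1002.1172: §1.1 Definition 1, Theorem 1, (5)–(8); §1 p. 2.
* [Reiris2014SSAF2] M. Reiris, *Stationary solutions and asymptotic flatness II*, Class. Quantum
  Grav. 31 (2014) 155013, arXiv:1310.0339: §1, Theorem 1 and the paragraph following it.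
* [Anderson2000Static] M. T. Anderson, *On the structure of solutions to the static vacuum
  Einstein equations*, Ann. Henri Poincaré 1 (2000) 995–1042, arXiv:gr-qc/0001018: (0.1), §0.
* [Bartnik1986] R. Bartnik, *The mass of an asymptotically flat manifold*, CPAM 39 (1986): §1
  (end structures; the tree's `AFEnd`).
-/

noncomputable section

open Bundle Set Function
open scoped Manifold ContDiff Topology

namespace Literature.Geometry.Lorentzian

variable {X : Type} [TopologicalSpace X] [ChartedSpace E3 X] [IsManifold (𝓡 3) ∞ X]

/-! ### The static vacuum Einstein equations on a region -/

/-- **The static vacuum Einstein equations on `A ⊆ X`** for a Riemannian metric `h = D.h` and a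
lapse `u : X → ℝ`: `u` is `C^∞`, and at every point of `A`, `u > 0`, `u · Ric_h = Hess_h u` and
`Δ_h u = 0` (Anderson's (0.1) "`u r = D²u`, `Δu = 0`, with `u` a positive function"; Reiris I
(E1)–(E2) with `ω = 0`).  Only the metric of `D` enters. [cite: Anderson2000Static, (0.1)]
[cite: Reiris2014SSAF1, §1.1 (E1)–(E2)] -/
def IsStaticVacuumOn (D : InitialDataSet (𝓡 3) X) [D.metric.HasLeviCivita] (u : X → ℝ)
    (A : Set X) : Prop :=
  ContMDiff (𝓡 3) 𝓘(ℝ, ℝ) ∞ u ∧ (∀ x ∈ A, 0 < u x) ∧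
    (∀ x ∈ A, ∀ v w : TangentSpace (𝓡 3) x,
      u x * D.metric.ricci x v w = D.metric.hessian u x v w) ∧
    (∀ x ∈ A, D.metric.dalembertian u x = 0)

namespace IsStaticVacuumOn

variable {D : InitialDataSet (𝓡 3) X} [D.metric.HasLeviCivita] {u : X → ℝ} {A B : Set X}

/-- The lapse of static vacuum data is smooth. [cite: Anderson2000Static, (0.1)] -/
theorem contMDiff (h : IsStaticVacuumOn D u A) : ContMDiff (𝓡 3) 𝓘(ℝ, ℝ) ∞ u := h.1

/-- The lapse is positive on the region. [cite: Anderson2000Static, (0.1)] -/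
theorem pos (h : IsStaticVacuumOn D u A) {x : X} (hx : x ∈ A) : 0 < u x := h.2.1 x hx

/-- `u Ric = Hess u` on the region. [cite: Anderson2000Static, (0.1)] -/
theorem ricci_eq (h : IsStaticVacuumOn D u A) {x : X} (hx : x ∈ A) (v w : TangentSpace (𝓡 3) x) :
    u x * D.metric.ricci x v w = D.metric.hessian u x v w := h.2.2.1 x hx v w

/-- `Δ u = 0` on the region. [cite: Anderson2000Static, (0.1)] -/
theorem dalembertian_eq (h : IsStaticVacuumOn D u A) {x : X} (hx : x ∈ A) :
    D.metric.dalembertian u x = 0 := h.2.2.2 x hx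

/-- The static vacuum equations restrict to subregions (Anderson considers solutions on domains and
their ends). [cite: Anderson2000Static, (0.1) and §0] -/
theorem mono (h : IsStaticVacuumOn D u A) (hBA : B ⊆ A) : IsStaticVacuumOn D u B :=
  ⟨h.1, fun x hx => h.2.1 x (hBA hx), fun x hx => h.2.2.1 x (hBA hx), fun x hx => h.2.2.2 x (hBA hx)⟩

end IsStaticVacuumOn

/-! ### Scalars in the chart of an end -/

namespace AFEnd

variable (e : AFEnd X)

/-- A scalar function `f : X → ℝ` **read in the chart of the end**: `f ∘ Φ` on `{R < ‖x‖}`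
(`Φ = e.dataChart` the inverse chart), junk value `0` inside the closed ball (like
`scalarCurvatureCoeff`). Bartnik 1986, §1. [cite: Bartnik1986, §1] -/
def scalarCoeff (f : X → ℝ) (x : E3) : ℝ :=
  if hx : e.R < ‖x‖ then f (e.dataChart ⟨x, hx⟩) else 0

omit [IsManifold (𝓡 3) ∞ X] in
/-- Outside the ball, `scalarCoeff e f x = f (Φ x)`. [cite: Bartnik1986, §1] -/
theorem scalarCoeff_of_lt (f : X → ℝ) {x : E3} (hx : e.R < ‖x‖) :
    e.scalarCoeff f x = f (e.dataChart ⟨x, hx⟩) := by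
  unfold scalarCoeff; rw [dif_pos hx]

end AFEnd

/-! ### Reiris's theorem, static case -/

/-- **Reiris 2014 (I, Theorem 1 + II, Theorem 1 and §1), static special case: a complete static
vacuum end diffeomorphic to `ℝ³ ∖ B` with lapse bounded away from zero is asymptotically flat
with Schwarzschildian fall-off.**  Printed (I, Thm 1): for a regular end `(E, (g̃, ω, u))` of a
stationary vacuum solution ("`E` homeomorphic to `ℝ³ ∖ B`", "`(E, |X|² g̃)` complete as a metric
space") "there is a coordinate system `{x̄}` such that the metric `g̃` is asymptotically flat, namely
`|δ_ij − g_ij| ≤ c/|x̄|`, `|∂_k g_ij| ≤ c/|x̄|²`. And we have the fall offs `|Ric_ij| ≤ c/|x̄|³`,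
`|∂_i u| + |ω_i| ≤ c/|x̄|²`"; (I, §1) "if `g̃` is complete and `|X| ≥ c > 0` then `g` is complete
and the stationary solution is asymptotically flat"; (II, §1) "Strongly Stationary ends are always
asymptotically flat with Schwarzschidian fall off".  Vendored with `ω = 0` and STRONGER
hypotheses (see the module docstring): `X` a connected boundaryless `3`-manifold, `e` its sole end
(`e.IsSoleEnd`), `(X, h)` geodesically complete, `u` smooth with `u ≥ u₀ > 0` and the static vacuum
equations `u Ric_h = Hess_h u`, `Δ_h u = 0` on the end `e.U`; conclusion = the displayed orders
(5)–(8) at the points `z`, `‖z‖ ≥ R₁`, of the exterior region of some end structure `e'` of the same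
end, componentwise in the standard frame (`δ_ij = if i = j then 1 else 0`; the Ricci clause is the
tree's `AFEnd.ricciCoeff e' D z` unfolded).  REFEREED. [cite: Reiris2014SSAF1, §1.1 Thm 1 (5)–(8) and §1 p. 2]
[cite: Reiris2014SSAF2, §1 Thm 1] -/
def Reiris2014_staticVacuumEnd_asymptoticallyFlat : Prop :=
  ∀ {X : Type} [TopologicalSpace X] [ChartedSpace E3 X] [IsManifold (𝓡 3) ∞ X]
    [T2Space X] [SecondCountableTopology X] [ConnectedSpace X]
    (e : AFEnd X) (D : InitialDataSet (𝓡 3) X) [D.metric.HasLeviCivita] (u : X → ℝ),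
    e.IsSoleEnd →
    IsGeodesicallyComplete D.metric.leviCivita →
    IsStaticVacuumOn D u (e.U : Set X) →
    (∃ u₀ : ℝ, 0 < u₀ ∧ ∀ x ∈ (e.U : Set X), u₀ ≤ u x) →
    ∃ (e' : AFEnd X) (c R₁ : ℝ), e'.IsSoleEnd ∧ e'.IsSameEnd e ∧
      ∀ z : exteriorRegion e'.R, R₁ ≤ ‖(z : E3)‖ → ∀ i j k : Fin 3,
        |AFEnd.hCoeff e' D z (EuclideanSpace.single i (1 : ℝ)) (EuclideanSpace.single j (1 : ℝ)) -
            (if i = j then 1 else 0)| ≤ c / ‖(z : E3)‖ ∧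
        |fderiv ℝ (fun y => AFEnd.hCoeff e' D y (EuclideanSpace.single i (1 : ℝ))
            (EuclideanSpace.single j (1 : ℝ))) z (EuclideanSpace.single k (1 : ℝ))| ≤
          c / ‖(z : E3)‖ ^ 2 ∧
        |pullbackBilin (I := 𝓡 3) (I' := 𝓡 3) e'.dataChart (fun x ↦ D.metric.ricciCLM x) z
            (EuclideanSpace.single i (1 : ℝ)) (EuclideanSpace.single j (1 : ℝ))| ≤ c / ‖(z : E3)‖ ^ 3 ∧
        |fderiv ℝ (e'.scalarCoeff u) z (EuclideanSpace.single i (1 : ℝ))| ≤ c / ‖(z : E3)‖ ^ 2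

/-- Hypothesis form of `Reiris2014_staticVacuumEnd_asymptoticallyFlat`.
[cite: Reiris2014SSAF1, §1.1 Thm 1] [cite: Reiris2014SSAF2, §1 Thm 1] -/
theorem Reiris2014_staticVacuumEnd_asymptoticallyFlat.apply
    (hR : Reiris2014_staticVacuumEnd_asymptoticallyFlat)
    {X : Type} [TopologicalSpace X] [ChartedSpace E3 X] [IsManifold (𝓡 3) ∞ X]
    [T2Space X] [SecondCountableTopology X] [ConnectedSpace X]
    (e : AFEnd X) (D : InitialDataSet (𝓡 3) X) [D.metric.HasLeviCivita] (u : X → ℝ)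
    (hsole : e.IsSoleEnd) (hcomplete : IsGeodesicallyComplete D.metric.leviCivita)
    (hstatic : IsStaticVacuumOn D u (e.U : Set X))
    (hu : ∃ u₀ : ℝ, 0 < u₀ ∧ ∀ x ∈ (e.U : Set X), u₀ ≤ u x) :
    ∃ (e' : AFEnd X) (c R₁ : ℝ), e'.IsSoleEnd ∧ e'.IsSameEnd e ∧
      ∀ z : exteriorRegion e'.R, R₁ ≤ ‖(z : E3)‖ → ∀ i j k : Fin 3,
        |AFEnd.hCoeff e' D z (EuclideanSpace.single i (1 : ℝ)) (EuclideanSpace.single j (1 : ℝ)) -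
            (if i = j then 1 else 0)| ≤ c / ‖(z : E3)‖ ∧
        |fderiv ℝ (fun y => AFEnd.hCoeff e' D y (EuclideanSpace.single i (1 : ℝ))
            (EuclideanSpace.single j (1 : ℝ))) z (EuclideanSpace.single k (1 : ℝ))| ≤
          c / ‖(z : E3)‖ ^ 2 ∧
        |pullbackBilin (I := 𝓡 3) (I' := 𝓡 3) e'.dataChart (fun x ↦ D.metric.ricciCLM x) z
            (EuclideanSpace.single i (1 : ℝ)) (EuclideanSpace.single j (1 : ℝ))| ≤ c / ‖(z : E3)‖ ^ 3 ∧
        |fderiv ℝ (e'.scalarCoeff u) z (EuclideanSpace.single i (1 : ℝ))| ≤ c / ‖(z : E3)‖ ^ 2 :=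
  hR e D u hsole hcomplete hstatic hu

end Literature.Geometry.Lorentzian

end
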